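import Literature.Computability.AlgebraicComplexity.BILPS19StabilizerMonomialProofs
import Mathlib.LinearAlgebra.Matrix.Permutation
import HarnessLib

/-!
# BILPS Thm 21 (stabilizer of `T_{k,n,r}`), the inclusion `⊇`: the explicit elements stabilise

Proof file (theorem-only, 0 named facts) toward `BILPS2019_thm21` of `BILPS19MinrankVarieties.lean`
(Bläser–Ikenmeyer–Lysikov–Pandey–Schreyer, arXiv:1911.02534, Thm 21, p0024:L5–11 and the proof's
"it is easy to see that `P_σ ∈ Stab T_{k,n,r}`", "any such `B̂` gives rise to
`(1, B̂, B̂^{-T}) ∈ Stab T_{k,n,r}`", p0024:L22, L33). We prove `{g | IsBILPSStabElement F g} ⊆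
stab3 (bilpsTensor F k' n r)` (`stab3_of_isBILPSStabElement`): for `A = P_σ diag(z)`,
`B = P̃_σ diag(Z₁, …, Z_k)`, `C = P̃_σ diag((z₁Z₁)^{-T}, …, (z_kZ_k)^{-T})` the slices of
`(A ⊗ B ⊗ C) T_{k,n,r}` are `B (z_{σa} Δ_{σa}) Cᵀ = P̃ (Z · z Δ · (zZ)⁻¹) P̃ᵀ = P̃ Δ_{σ a} P̃ᵀ = Δ_a`
(`Δ_a` the diagonal indicator of the block `a`; block algebra `blockDiag3_mul`,
`diagonal_blockIndicator_eq_blockDiag3`, conjugation by the block permutation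
`permMatrix_mul_mul_transpose_apply`). Together with `BILPS2019_thm21_step1`/`step1b`
(`BILPS19StabilizerMonomialProofs.lean`) this leaves, for the named fact `BILPS2019_thm21`, only
the `B`/`C` structure of the inclusion `⊆` (printed p0024:L25–38). Valid over every field.
Honest framing (val-lit, row X5-BILPS19): nothing here bears on `VP ≠ VNP`, which is NOT proved.
-/

noncomputable section

namespace Literature.Computability.AlgebraicComplexity

open Matrix

section Thm21Superset

open scoped Classical

variable {F : Type*} [Field F] {k' n r : ℕ}

/-- Product of two block-diagonal matrices on `L = F^r ⊕ (F^n)^{k'}`.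
[cite: BlaserIkenmeyerLysikovPandeySchreyer2019, Thm. 21 (proof)] -/
theorem blockDiag3_mul (A₀ B₀ : Matrix (Fin r) (Fin r) F) (A B : Fin k' → Matrix (Fin n) (Fin n) F) :
    blockDiag3 F A₀ A * blockDiag3 F B₀ B = blockDiag3 F (A₀ * B₀) (fun i => A i * B i) := by
  unfold blockDiag3
  rw [Matrix.fromBlocks_multiply]
  simp [Matrix.blockDiagonal_mul]

/-- Transpose of a block-diagonal matrix. [cite: BlaserIkenmeyerLysikovPandeySchreyer2019, Thm. 21 (proof)] -/
theorem blockDiag3_transpose (A₀ : Matrix (Fin r) (Fin r) F) (A : Fin k' → Matrix (Fin n) (Fin n) F) :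
    (blockDiag3 F A₀ A)ᵀ = blockDiag3 F A₀ᵀ (fun i => (A i)ᵀ) := by
  unfold blockDiag3
  rw [Matrix.fromBlocks_transpose, Matrix.blockDiagonal_transpose, Matrix.transpose_zero,
    Matrix.transpose_zero]

/-- Scalar multiples of block-diagonal matrices. [cite: BlaserIkenmeyerLysikovPandeySchreyer2019, Thm. 21 (proof)] -/
theorem smul_blockDiag3 (c : F) (A₀ : Matrix (Fin r) (Fin r) F) (A : Fin k' → Matrix (Fin n) (Fin n) F) :
    c • blockDiag3 F A₀ A = blockDiag3 F (c • A₀) (fun i => c • A i) := by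
  unfold blockDiag3
  rw [Matrix.fromBlocks_smul, smul_zero, smul_zero, ← Matrix.blockDiagonal_smul]
  rfl

/-- The diagonal indicator `Δ_a` of the block `a` is block diagonal with identity/zero blocks.
[cite: BlaserIkenmeyerLysikovPandeySchreyer2019, Thm. 21 (proof)] -/
theorem diagonal_blockIndicator_eq_blockDiag3 (a : Option (Fin k')) :
    Matrix.diagonal (fun x : BIdx k' n r =>
        if (Sum.elim (fun _ => (none : Option (Fin k'))) (fun q => some q.2) x) = a then (1 : F)
        else 0) =
      blockDiag3 F (if a = none then 1 else 0) (fun i => if a = some i then 1 else 0) := by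
  ext x y
  unfold blockDiag3
  rcases x with j | ⟨j, i⟩ <;> rcases y with j' | ⟨j', i'⟩
  · rw [Matrix.fromBlocks_apply₁₁]
    by_cases ha : a = none
    · subst ha
      by_cases hj : j = j' <;> simp [Matrix.one_apply, hj]
    · by_cases hj : j = j' <;> simp [hj, ha, Ne.symm ha]
  · rw [Matrix.fromBlocks_apply₁₂]
    simp
  · rw [Matrix.fromBlocks_apply₂₁]
    simp
  · rw [Matrix.fromBlocks_apply₂₂, Matrix.blockDiagonal_apply']
    by_cases hi : i = i'
    · subst hi
      by_cases ha : a = some i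
      · subst ha
        by_cases hj : j = j' <;> simp [Matrix.one_apply, hj]
      · by_cases hj : j = j' <;> simp [hj, ha, Ne.symm ha]
    · simp [hi]

/-- The slice `a` of `T_{k,n,r}` is the diagonal indicator `Δ_a` of the block `a`.
[cite: BlaserIkenmeyerLysikovPandeySchreyer2019, §6.1 (definition of T_{k,n,r})] -/
theorem of_bilpsTensor_eq_diagonal (a : Option (Fin k')) :
    Matrix.of (bilpsTensor F k' n r a) =
      Matrix.diagonal (fun x : BIdx k' n r =>
        if (Sum.elim (fun _ => (none : Option (Fin k'))) (fun q => some q.2) x) = a then (1 : F)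
        else 0) := by
  have h := sum_smul_bilpsSlice_eq_diagonal (F := F) (k' := k') (n := n) (r := r)
    (fun a' => if a' = a then (1 : F) else 0)
  rw [Finset.sum_eq_single a (fun a' _ ha' => by rw [if_neg ha', zero_smul])
    (fun h => absurd (Finset.mem_univ a) h), if_pos rfl, one_smul] at h
  exact h

/-- The block permutation `P̃_σ` moves block `a` to block `σ'(a)`, `σ' = optionCongr σ`.
[cite: BlaserIkenmeyerLysikovPandeySchreyer2019, Thm. 21] -/
theorem blk_blockPerm (σ : Equiv.Perm (Fin k')) (b : BIdx k' n r) :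
    (Sum.elim (fun _ => (none : Option (Fin k'))) (fun q => some q.2) (blockPerm (n := n) (r := r) σ b)) =
      Equiv.optionCongr σ (Sum.elim (fun _ => (none : Option (Fin k'))) (fun q => some q.2) b) := by
  rcases b with j | ⟨j, i⟩
  · rfl
  · rfl

/-- Conjugation by a permutation matrix: `(P_ρ M P_ρᵀ)_{b c} = M_{ρ b, ρ c}`.
[cite: BlaserIkenmeyerLysikovPandeySchreyer2019, Thm. 21 (proof)] -/
theorem permMatrix_mul_mul_transpose_apply {ν : Type*} [Fintype ν] [DecidableEq ν]
    (ρ : Equiv.Perm ν) (M : Matrix ν ν F) (b c : ν) :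
    (Equiv.Perm.permMatrix F ρ * M * (Equiv.Perm.permMatrix F ρ)ᵀ) b c = M (ρ b) (ρ c) := by
  rw [Matrix.transpose_permMatrix, Matrix.mul_assoc, PEquiv.toMatrix_mul_apply, Equiv.toPEquiv_apply]
  simp only []
  rw [PEquiv.mul_toMatrix_apply, ← Equiv.toPEquiv_symm, Equiv.toPEquiv_apply]
  simp only []
  rw [Equiv.Perm.inv_def, Equiv.symm_symm]

/-- **The block algebra of the printed proof**: `diag(Z) · (z_{a} Δ_a) · diag((zZ)⁻¹) = Δ_a`
("`(Â⁻¹, 1, Â')` also preserves `T_{k,n,r}`", p0024:L27; "any such `B̂` gives rise to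
`(1, B̂, B̂^{-T})`", p0024:L33). [cite: BlaserIkenmeyerLysikovPandeySchreyer2019, Thm. 21 (proof)] -/
theorem blockDiag3_mul_blockIndicator_mul (z : Option (Fin k') → Fˣ) (Z₀ : GL (Fin r) F)
    (Z : Fin k' → GL (Fin n) F) (a : Option (Fin k')) :
    blockDiag3 F (↑Z₀ : Matrix (Fin r) (Fin r) F) (fun i => (↑(Z i) : Matrix (Fin n) (Fin n) F)) *
        ((z a : F) • Matrix.diagonal (fun x : BIdx k' n r =>
          if (Sum.elim (fun _ => (none : Option (Fin k'))) (fun q => some q.2) x) = a then (1 : F)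
          else 0)) *
        blockDiag3 F (((z none : F) • (↑Z₀ : Matrix (Fin r) (Fin r) F))⁻¹)
          (fun i => (((z (some i) : F) • (↑(Z i) : Matrix (Fin n) (Fin n) F))⁻¹)) =
      Matrix.diagonal (fun x : BIdx k' n r =>
          if (Sum.elim (fun _ => (none : Option (Fin k'))) (fun q => some q.2) x) = a then (1 : F)
          else 0) := by
  have hZ₀ : IsUnit (↑Z₀ : Matrix (Fin r) (Fin r) F).det := (Matrix.isUnit_iff_isUnit_det _).1 Z₀.isUnit
  have hZ : ∀ i, IsUnit (↑(Z i) : Matrix (Fin n) (Fin n) F).det :=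
    fun i => (Matrix.isUnit_iff_isUnit_det _).1 (Z i).isUnit
  have hsmulinv : ∀ {m : Type} [Fintype m] [DecidableEq m] (c : F) (hc : c ≠ 0) (M : Matrix m m F),
      IsUnit M.det → M * (c • M)⁻¹ = c⁻¹ • (1 : Matrix m m F) := by
    intro m _ _ c hc M hM
    have hinv : (c • M)⁻¹ = c⁻¹ • M⁻¹ := by
      apply Matrix.inv_eq_right_inv
      rw [Matrix.smul_mul, Matrix.mul_smul, smul_smul, mul_inv_cancel₀ hc, one_smul,
        Matrix.mul_nonsing_inv _ hM]
    rw [hinv, Matrix.mul_smul, Matrix.mul_nonsing_inv _ hM]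
  have hinv₀ : (↑Z₀ : Matrix (Fin r) (Fin r) F) * ((z none : F) • (↑Z₀ : Matrix (Fin r) (Fin r) F))⁻¹ =
      ((z none : F))⁻¹ • (1 : Matrix (Fin r) (Fin r) F) := hsmulinv _ (z none).ne_zero _ hZ₀
  have hinv : ∀ i, (↑(Z i) : Matrix (Fin n) (Fin n) F) *
      ((z (some i) : F) • (↑(Z i) : Matrix (Fin n) (Fin n) F))⁻¹ =
      ((z (some i) : F))⁻¹ • (1 : Matrix (Fin n) (Fin n) F) :=
    fun i => hsmulinv _ (z (some i)).ne_zero _ (hZ i)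
  rw [diagonal_blockIndicator_eq_blockDiag3, smul_blockDiag3, blockDiag3_mul, blockDiag3_mul]
  congr 1
  · by_cases ha : a = none
    · subst ha
      rw [if_pos rfl, Matrix.mul_smul, Matrix.mul_one, Matrix.smul_mul, hinv₀, smul_smul,
        mul_inv_cancel₀ (z none).ne_zero, one_smul]
    · rw [if_neg ha, smul_zero, Matrix.mul_zero, Matrix.zero_mul]
  · funext i
    by_cases ha : a = some i
    · subst ha
      rw [if_pos rfl, Matrix.mul_smul, Matrix.mul_one, Matrix.smul_mul, hinv i, smul_smul,
        mul_inv_cancel₀ (z (some i)).ne_zero, one_smul]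
    · rw [if_neg ha, smul_zero, Matrix.mul_zero, Matrix.zero_mul]

/-- **BILPS Thm 21, inclusion `⊇`: the explicit elements `(P_σ diag(z), P̃_σ diag(Z),
P̃_σ diag((zZ)^{-T}))` stabilise `T_{k,n,r}`** (p0024:L5–11, L22, L27, L33).
[cite: BlaserIkenmeyerLysikovPandeySchreyer2019, Thm. 21] -/
theorem stab3_of_isBILPSStabElement
    (g : GL (Option (Fin k')) F × GL (BIdx k' n r) F × GL (BIdx k' n r) F)
    (hg : IsBILPSStabElement F g) : g ∈ stab3 (bilpsTensor F k' n r) := by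
  obtain ⟨σ, z, Z₀, Z, hA, hB, hC⟩ := hg
  show actTensor (g.1 : Matrix (Option (Fin k')) (Option (Fin k')) F)
    (g.2.1 : Matrix (BIdx k' n r) (BIdx k' n r) F) (g.2.2 : Matrix (BIdx k' n r) (BIdx k' n r) F)
    (bilpsTensor F k' n r) = bilpsTensor F k' n r
  funext a
  apply Matrix.of.injective
  rw [actTensor_slice_eq_mul_sum_mul, hA, hB, hC]
  -- the `A`-combination of slices
  have hsum : (∑ a', (Equiv.Perm.permMatrix F (Equiv.optionCongr σ) *
      Matrix.diagonal (fun a => (z a : F))) a a' • Matrix.of (bilpsTensor F k' n r a')) =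
      (z (Equiv.optionCongr σ a) : F) • Matrix.diagonal (fun x : BIdx k' n r =>
        if (Sum.elim (fun _ => (none : Option (Fin k'))) (fun q => some q.2) x) =
          Equiv.optionCongr σ a then (1 : F) else 0) := by
    rw [Finset.sum_eq_single (Equiv.optionCongr σ a)]
    · rw [PEquiv.toMatrix_mul_apply, Equiv.toPEquiv_apply]
      simp only []
      rw [Matrix.diagonal_apply_eq, of_bilpsTensor_eq_diagonal]
    · intro a' _ ha'
      rw [PEquiv.toMatrix_mul_apply, Equiv.toPEquiv_apply]
      simp only []
      rw [Matrix.diagonal_apply_ne _ (Ne.symm ha'), zero_smul]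
    · exact fun h => absurd (Finset.mem_univ _) h
  rw [hsum, Matrix.transpose_mul, blockDiag3_transpose]
  simp only [Matrix.transpose_transpose]
  rw [show ∀ (P BD D BDi Pt : Matrix (BIdx k' n r) (BIdx k' n r) F),
      P * BD * D * (BDi * Pt) = P * (BD * D * BDi) * Pt from fun P BD D BDi Pt => by
        simp only [Matrix.mul_assoc],
    blockDiag3_mul_blockIndicator_mul, of_bilpsTensor_eq_diagonal]
  ext b c
  rw [permMatrix_mul_mul_transpose_apply, Matrix.diagonal_apply, Matrix.diagonal_apply,
    blk_blockPerm]
  simp only [EmbeddingLike.apply_eq_iff_eq]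

end Thm21Superset

end Literature.Computability.AlgebraicComplexity
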